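import Summits.SmoothPoincare4.SmoothPoincare4.Theorems.SullivanDualWitnessChargeStubCollarPrelim
import Summits.SmoothPoincare4.SmoothPoincare4.Theorems.SullivanDualWitnessChargeStubCollarFlat
import Summits.SmoothPoincare4.SmoothPoincare4.Theorems.SullivanDualWitnessChargeStubCollarChart

/-!
# Collar lemma for taming witnesses (4/5): domination of a smooth form by `‖A v‖²` off the ball

Support file for the stub `stub_collar` of the line `Sketch` (pencil-incompleteness) of the crux
`WitnessCharge` (`stmt-SmoothPoincare4-7824`, thesis `SullivanDual`); free of definitions.

For `J` standard on the punctured `ε'`-chart-ball at `p` (`⟪A(Jv), c⟫ = ω₀(Av, c)`,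
`A = Dι(e x - e p) ∘ D(e ∘ val)(x)` the differential of the inverted recentred chart `Y`), a
`2`-form `α` on `M ∖ {p}` smooth at a point `x₀` of the ball satisfies, near `x₀`,
`|α_x(v, J v)| ≤ C ‖A_x v‖²` (`local_bound`): in the chart of `M ∖ {p}` at `x₀` the
representative of `α` is bounded near the centre, and the differential of `Y` read in that
chart, `B_y = A ∘ D(e₀⁻¹)(y)`, is continuous in `y` and injective at the centre, hence uniformly
bounded below nearby. On a COMPACT manifold the complement `K_ε` of the punctured `ε`-ball is
compact, so for a smooth `α` vanishing off the `ε₂`-ball, `ε₂ < ε'`, one constant serves on all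
of `K_ε` (`stub_collar_domination`, the registered sub-goal of this file).

## References

* M. Gromov, *Pseudo holomorphic curves in symplectic manifolds*, Invent. Math. 82 (1985),
  §0.3.C, 2.4.A. [Gromov1985]
-/

noncomputable section

-- Justification: all stub files of the line share the namespace of the skeleton
-- (`…Theorems.WitnessCharge.PencilIncompleteness`), which repeats the component `SmoothPoincare4`.
set_option linter.dupNamespace false

open scoped Manifold ContDiff Topology RealInnerProductSpace
open Set Filter Literature.Geometry.Kaehler Literature.Geometry.Symplectic
  Literature.Topology.FourManifolds

namespace Summit.SmoothPoincare4.SmoothPoincare4.Theorems.WitnessCharge.PencilIncompleteness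

variable {M : Type*} [TopologicalSpace M] [T2Space M] [ChartedSpace (EuclideanSpace ℝ (Fin 4)) M]
  [IsManifold (𝓡 4) ∞ M]

/-- `D(e ∘ val)(x)` is injective over the chart source (the chart differential is invertible,
the inclusion of the open submanifold has identity differential). [folklore] -/
theorem mfderiv_extChartAt_val_injective (p : M) {x : punctured p}
    (hx : x.1 ∈ (chartAt (EuclideanSpace ℝ (Fin 4)) p).source) :
    Function.Injective (mfderiv (𝓡 4) 𝓘(ℝ, EuclideanSpace ℝ (Fin 4))
      (fun z : punctured p => extChartAt (𝓡 4) p z.1) x) := by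
  have hxs : x.1 ∈ (extChartAt (𝓡 4) p).source := by rwa [extChartAt_source]
  have h1 : mfderiv (𝓡 4) 𝓘(ℝ, EuclideanSpace ℝ (Fin 4))
      ((extChartAt (𝓡 4) p) ∘ (Subtype.val : punctured p → M)) x =
      (mfderiv (𝓡 4) 𝓘(ℝ, EuclideanSpace ℝ (Fin 4)) (extChartAt (𝓡 4) p) x.1).comp
        (mfderiv (𝓡 4) (𝓡 4) (Subtype.val : punctured p → M) x) :=
    mfderiv_comp x (mdifferentiableAt_extChartAt hx)
      ((contMDiff_subtype_val (I := 𝓡 4) (n := ∞) (U := punctured p) x).mdifferentiableAt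
        (by simp))
  change Function.Injective (mfderiv (𝓡 4) 𝓘(ℝ, EuclideanSpace ℝ (Fin 4))
    ((extChartAt (𝓡 4) p) ∘ (Subtype.val : punctured p → M)) x)
  rw [h1, Literature.Geometry.Manifold.OpenSubmanifold.mfderiv_subtype_val]
  obtain ⟨L, hL⟩ := isInvertible_mfderiv_extChartAt (I := 𝓡 4) hxs
  intro a b hab
  have hab' : mfderiv (𝓡 4) 𝓘(ℝ, EuclideanSpace ℝ (Fin 4)) (extChartAt (𝓡 4) p) x.1 a =
      mfderiv (𝓡 4) 𝓘(ℝ, EuclideanSpace ℝ (Fin 4)) (extChartAt (𝓡 4) p) x.1 b := hab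
  rw [← hL] at hab'
  exact L.injective hab'

/-- `A_x = Dι(e x - e p) ∘ D(e ∘ val)(x)` is injective over the chart source. [folklore] -/
theorem fderiv_inversion_mfderiv_injective (p : M) {x : punctured p}
    (hx : x.1 ∈ (chartAt (EuclideanSpace ℝ (Fin 4)) p).source) :
    Function.Injective fun v : TangentSpace (𝓡 4) x =>
      fderiv ℝ inversion (extChartAt (𝓡 4) p x.1 - extChartAt (𝓡 4) p p)
        (mfderiv (𝓡 4) 𝓘(ℝ, EuclideanSpace ℝ (Fin 4))
          (fun z : punctured p => extChartAt (𝓡 4) p z.1) x v) :=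
  (fderiv_inversion_injective (extChartAt_sub_ne_zero p hx)).comp
    (mfderiv_extChartAt_val_injective p hx)

/-! ### The local domination bound -/

/-- **Local domination.** Let `J` be standard on the punctured `ε'`-ball
(`⟪A(Jv), c⟫ = ω₀(Av, c)`) and let `α` be a `2`-form smooth at a point `x₀` of that ball. Then
there is `C ≥ 0` with `|α_x(v, J_x v)| ≤ C ‖A_x v‖²` for all `x` near `x₀` and all `v`. Proof: in
the chart `e₀` of `M ∖ {p}` at `x₀`, `α_x(v, Jv) = α^{e₀}(y)(u₁, u₂)` with `D(e₀⁻¹)(y) uᵢ = v, Jv`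
and `α^{e₀}` bounded near the centre, while `B_y = A_x ∘ D(e₀⁻¹)(y) = D(Y ∘ e₀⁻¹)(y)` is
continuous in `y` and injective at the centre, so `‖u‖ ≤ 2K ‖B_y u‖` nearby; with
`‖A (J v)‖ = ‖A v‖` this gives `C = C₁ (2K)²`. [cite: Gromov1985, 2.4.A] -/
theorem local_bound (p : M) {ε' : ℝ}
    {J : ∀ x : punctured p, TangentSpace (𝓡 4) x →L[ℝ] TangentSpace (𝓡 4) x}
    (hJstd : ∀ x : punctured p, InPuncturedChartBall p ε' x →
      ∀ (v : TangentSpace (𝓡 4) x) (b : EuclideanSpace ℝ (Fin 4)),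
        inner ℝ (fderiv ℝ inversion (extChartAt (𝓡 4) p x.1 - extChartAt (𝓡 4) p p)
          (mfderiv (𝓡 4) 𝓘(ℝ, EuclideanSpace ℝ (Fin 4))
            (fun z : punctured p => extChartAt (𝓡 4) p z.1) x (J x v))) b
        = stdSymplecticForm (fderiv ℝ inversion (extChartAt (𝓡 4) p x.1 - extChartAt (𝓡 4) p p)
          (mfderiv (𝓡 4) 𝓘(ℝ, EuclideanSpace ℝ (Fin 4))
            (fun z : punctured p => extChartAt (𝓡 4) p z.1) x v)) b)
    {α : MForm (𝓡 4) (punctured p) ℝ 2} {x₀ : punctured p} (hα : α.SmoothAt x₀)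
    (hx₀ : InPuncturedChartBall p ε' x₀) :
    ∃ C : ℝ, 0 ≤ C ∧ ∀ᶠ x in 𝓝 x₀, ∀ v : TangentSpace (𝓡 4) x,
      |α x ![v, J x v]| ≤ C * ‖fderiv ℝ inversion (extChartAt (𝓡 4) p x.1 - extChartAt (𝓡 4) p p)
        (mfderiv (𝓡 4) 𝓘(ℝ, EuclideanSpace ℝ (Fin 4))
          (fun z : punctured p => extChartAt (𝓡 4) p z.1) x v)‖ ^ 2 := by
  set e₀ := extChartAt (𝓡 4) x₀ with he₀
  have hr : (range (𝓡 4) : Set (EuclideanSpace ℝ (Fin 4))) = univ := by simp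
  -- (i) the chart representative of `α` is bounded near the centre
  have hαc : ContinuousAt (α.inChart x₀) (e₀ x₀) := by
    have h : ContDiffWithinAt ℝ ∞ (α.inChart x₀) (range (𝓡 4)) (e₀ x₀) := hα
    rw [hr] at h
    exact (h.contDiffAt univ_mem).continuousAt
  set C₁ : ℝ := ‖α.inChart x₀ (e₀ x₀)‖ + 1 with hC₁
  have hb1 : ∀ᶠ y in 𝓝 (e₀ x₀), ‖α.inChart x₀ y‖ ≤ C₁ :=
    (hαc.norm.eventually_lt continuousAt_const (lt_add_one _)).mono fun y hy => hy.le
  -- (ii) `g = Y ∘ e₀⁻¹` is `C^∞` at the centre, so `Dg` is continuous there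
  set Y : punctured p → EuclideanSpace ℝ (Fin 4) :=
    fun z : punctured p => inversion (extChartAt (𝓡 4) p z.1 - extChartAt (𝓡 4) p p) with hY
  have hYs : ContMDiffAt (𝓡 4) 𝓘(ℝ, EuclideanSpace ℝ (Fin 4)) ∞ Y x₀ :=
    contMDiffAt_inversion_extChartAt_sub p hx₀.1
  have hgs : ContDiffAt ℝ ∞ (Y ∘ e₀.symm) (e₀ x₀) := by
    have h := (contMDiffAt_iff.1 hYs).2
    simp only [extChartAt_model_space_eq_id, PartialEquiv.refl_coe, Function.id_comp,
      modelWithCornersSelf_coe, range_id] at h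
    exact h.contDiffAt univ_mem
  have hDg : ContinuousAt (fderiv ℝ (Y ∘ e₀.symm)) (e₀ x₀) :=
    (hgs.fderiv_right (m := 0) (by norm_cast)).continuousAt
  -- (iii) `Dg(y) u = A (D(e₀⁻¹)(y) u)` over the chart source
  have hkey : ∀ y ∈ e₀.target, (e₀.symm y).1 ∈ (chartAt (EuclideanSpace ℝ (Fin 4)) p).source →
      ∀ u : EuclideanSpace ℝ (Fin 4), fderiv ℝ (Y ∘ e₀.symm) y u =
        fderiv ℝ inversion (extChartAt (𝓡 4) p (e₀.symm y).1 - extChartAt (𝓡 4) p p)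
          (mfderiv (𝓡 4) 𝓘(ℝ, EuclideanSpace ℝ (Fin 4))
            (fun z : punctured p => extChartAt (𝓡 4) p z.1) (e₀.symm y)
            (mfderivWithin 𝓘(ℝ, EuclideanSpace ℝ (Fin 4)) (𝓡 4) e₀.symm (range (𝓡 4)) y u)) := by
    intro y hy hys u
    have hU : UniqueMDiffWithinAt 𝓘(ℝ, EuclideanSpace ℝ (Fin 4)) (range (𝓡 4)) y :=
      ((𝓡 4).uniqueDiffOn y (extChartAt_target_subset_range x₀ hy)).uniqueMDiffWithinAt
    have hYd : MDifferentiableAt (𝓡 4) 𝓘(ℝ, EuclideanSpace ℝ (Fin 4)) Y (e₀.symm y) :=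
      (contMDiffAt_inversion_extChartAt_sub p hys).mdifferentiableAt (by simp)
    have h1 := mfderiv_comp_mfderivWithin y hYd (mdifferentiableWithinAt_extChartAt_symm hy) hU
    rw [mfderivWithin_eq_fderivWithin] at h1
    have h2 : fderivWithin ℝ (Y ∘ e₀.symm) (range (𝓡 4)) y u =
        mfderiv (𝓡 4) 𝓘(ℝ, EuclideanSpace ℝ (Fin 4)) Y (e₀.symm y)
          (mfderivWithin 𝓘(ℝ, EuclideanSpace ℝ (Fin 4)) (𝓡 4) e₀.symm (range (𝓡 4)) y u) :=
      DFunLike.congr_fun h1 u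
    rw [mfderiv_inversion_extChartAt_sub p _ hys] at h2
    have h3 : fderiv ℝ (Y ∘ e₀.symm) y = fderivWithin ℝ (Y ∘ e₀.symm) (range (𝓡 4)) y := by
      rw [hr, fderivWithin_univ]
    exact (DFunLike.congr_fun h3 u).trans h2
  -- (iv) at the centre `Dg = A_{x₀}`, injective, hence bounded below
  have hx₀' : e₀.symm (e₀ x₀) = x₀ := extChartAt_to_inv x₀
  have hB0 : ∀ u : EuclideanSpace ℝ (Fin 4), fderiv ℝ (Y ∘ e₀.symm) (e₀ x₀) u =
      fderiv ℝ inversion (extChartAt (𝓡 4) p x₀.1 - extChartAt (𝓡 4) p p)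
        (mfderiv (𝓡 4) 𝓘(ℝ, EuclideanSpace ℝ (Fin 4))
          (fun z : punctured p => extChartAt (𝓡 4) p z.1) x₀ u) := by
    intro u
    have hP0 : mfderivWithin 𝓘(ℝ, EuclideanSpace ℝ (Fin 4)) (𝓡 4) e₀.symm (range (𝓡 4))
        (e₀ x₀) u = u :=
      DFunLike.congr_fun (mfderivWithin_range_extChartAt_symm (I := 𝓡 4) (x := x₀)) u
    have h := hkey (e₀ x₀) (mem_extChartAt_target x₀) (by rw [hx₀']; exact hx₀.1) u
    rw [hP0, hx₀'] at h
    exact h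
  obtain ⟨K, hK, hK'⟩ := exists_bound_of_injective
    (B := (fderiv ℝ inversion (extChartAt (𝓡 4) p x₀.1 - extChartAt (𝓡 4) p p)).comp
      (mfderiv (𝓡 4) 𝓘(ℝ, EuclideanSpace ℝ (Fin 4))
        (fun z : punctured p => extChartAt (𝓡 4) p z.1) x₀))
    (fderiv_inversion_mfderiv_injective p hx₀.1)
  have hK'' : ∀ u : EuclideanSpace ℝ (Fin 4), ‖u‖ ≤ K * ‖fderiv ℝ (Y ∘ e₀.symm) (e₀ x₀) u‖ :=
    fun u => by
      rw [hB0 u]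
      exact hK' u
  -- (v) nearby `‖Dg(y) - Dg(y₀)‖ ≤ (2K)⁻¹`, inside the target, over the ball
  have hb2 : ∀ᶠ y in 𝓝 (e₀ x₀), ‖fderiv ℝ (Y ∘ e₀.symm) y -
      fderiv ℝ (Y ∘ e₀.symm) (e₀ x₀)‖ ≤ (2 * K)⁻¹ := by
    have h := Metric.tendsto_nhds.1 hDg.tendsto ((2 * K)⁻¹) (by positivity)
    exact h.mono fun y hy => by rw [dist_eq_norm] at hy; exact hy.le
  have hb3 : ∀ᶠ y in 𝓝 (e₀ x₀), y ∈ e₀.target := extChartAt_target_mem_nhds x₀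
  have hb4 : ∀ᶠ y in 𝓝 (e₀ x₀), InPuncturedChartBall p ε' (e₀.symm y) := by
    have hc : ContinuousAt e₀.symm (e₀ x₀) := continuousAt_extChartAt_symm x₀
    have h : ∀ᶠ z in 𝓝 (e₀.symm (e₀ x₀)), InPuncturedChartBall p ε' z := by
      rw [hx₀']
      exact (isOpen_setOf_inPuncturedChartBall p ε').mem_nhds hx₀
    exact hc.eventually h
  -- (vi) the bound at the good points of the chart
  have hgood : ∀ᶠ y in 𝓝 (e₀ x₀), ∀ v : TangentSpace (𝓡 4) (e₀.symm y),
      |α (e₀.symm y) ![v, J _ v]| ≤ (C₁ * (2 * K) ^ 2) *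
        ‖fderiv ℝ inversion (extChartAt (𝓡 4) p (e₀.symm y).1 - extChartAt (𝓡 4) p p)
          (mfderiv (𝓡 4) 𝓘(ℝ, EuclideanSpace ℝ (Fin 4))
            (fun z : punctured p => extChartAt (𝓡 4) p z.1) (e₀.symm y) v)‖ ^ 2 := by
    filter_upwards [hb1, hb2, hb3, hb4] with y h1 h2 h3 h4 v
    set P := mfderivWithin 𝓘(ℝ, EuclideanSpace ℝ (Fin 4)) (𝓡 4) e₀.symm (range (𝓡 4)) y
      with hP
    set Q := mfderiv (𝓡 4) 𝓘(ℝ, EuclideanSpace ℝ (Fin 4)) e₀ (e₀.symm y) with hQ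
    have hPQ : ∀ w : TangentSpace (𝓡 4) (e₀.symm y), P (Q w) = w := fun w =>
      DFunLike.congr_fun (mfderivWithin_extChartAt_symm_comp_mfderiv_extChartAt (I := 𝓡 4) h3) w
    have hB : ∀ u : EuclideanSpace ℝ (Fin 4), ‖u‖ ≤ 2 * K *
        ‖fderiv ℝ inversion (extChartAt (𝓡 4) p (e₀.symm y).1 - extChartAt (𝓡 4) p p)
          (mfderiv (𝓡 4) 𝓘(ℝ, EuclideanSpace ℝ (Fin 4))
            (fun z : punctured p => extChartAt (𝓡 4) p z.1) (e₀.symm y) (P u))‖ := by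
      intro u
      have hb := bound_of_norm_sub_le hK hK'' h2 u
      rw [hkey y h3 h4.1 u] at hb
      exact hb
    obtain ⟨u₁, hu₁⟩ : ∃ u : EuclideanSpace ℝ (Fin 4), P u = v := ⟨Q v, hPQ v⟩
    obtain ⟨u₂, hu₂⟩ : ∃ u : EuclideanSpace ℝ (Fin 4), P u = J _ v := ⟨Q (J _ v), hPQ _⟩
    have hrepr : α (e₀.symm y) ![v, J _ v] = α.inChart x₀ y ![u₁, u₂] := by
      rw [MForm.inChart_apply]
      congr 1
      funext i
      fin_cases i
      · exact hu₁.symm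
      · exact hu₂.symm
    have hle : |α.inChart x₀ y ![u₁, u₂]| ≤ ‖α.inChart x₀ y‖ * (‖u₁‖ * ‖u₂‖) := by
      have h := (α.inChart x₀ y).le_opNorm ![u₁, u₂]
      rw [Fin.prod_univ_two] at h
      simpa [Real.norm_eq_abs] using h
    have hu₁' : ‖u₁‖ ≤ 2 * K *
        ‖fderiv ℝ inversion (extChartAt (𝓡 4) p (e₀.symm y).1 - extChartAt (𝓡 4) p p)
          (mfderiv (𝓡 4) 𝓘(ℝ, EuclideanSpace ℝ (Fin 4))
            (fun z : punctured p => extChartAt (𝓡 4) p z.1) (e₀.symm y) v)‖ := by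
      have h := hB u₁
      rwa [hu₁] at h
    have hu₂' : ‖u₂‖ ≤ 2 * K *
        ‖fderiv ℝ inversion (extChartAt (𝓡 4) p (e₀.symm y).1 - extChartAt (𝓡 4) p p)
          (mfderiv (𝓡 4) 𝓘(ℝ, EuclideanSpace ℝ (Fin 4))
            (fun z : punctured p => extChartAt (𝓡 4) p z.1) (e₀.symm y) v)‖ := by
      have h := hB u₂
      rwa [hu₂, norm_eq_of_inner_eq_std (hJstd _ h4 v)] at h
    calc |α (e₀.symm y) ![v, J _ v]| = |α.inChart x₀ y ![u₁, u₂]| := by rw [hrepr]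
      _ ≤ ‖α.inChart x₀ y‖ * (‖u₁‖ * ‖u₂‖) := hle
      _ ≤ C₁ * ((2 * K *
          ‖fderiv ℝ inversion (extChartAt (𝓡 4) p (e₀.symm y).1 - extChartAt (𝓡 4) p p)
            (mfderiv (𝓡 4) 𝓘(ℝ, EuclideanSpace ℝ (Fin 4))
              (fun z : punctured p => extChartAt (𝓡 4) p z.1) (e₀.symm y) v)‖) * (2 * K *
          ‖fderiv ℝ inversion (extChartAt (𝓡 4) p (e₀.symm y).1 - extChartAt (𝓡 4) p p)
            (mfderiv (𝓡 4) 𝓘(ℝ, EuclideanSpace ℝ (Fin 4))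
              (fun z : punctured p => extChartAt (𝓡 4) p z.1) (e₀.symm y) v)‖)) :=
          mul_le_mul h1 (mul_le_mul hu₁' hu₂' (norm_nonneg _) (by positivity)) (by positivity)
            (by positivity)
      _ = C₁ * (2 * K) ^ 2 *
          ‖fderiv ℝ inversion (extChartAt (𝓡 4) p (e₀.symm y).1 - extChartAt (𝓡 4) p p)
            (mfderiv (𝓡 4) 𝓘(ℝ, EuclideanSpace ℝ (Fin 4))
              (fun z : punctured p => extChartAt (𝓡 4) p z.1) (e₀.symm y) v)‖ ^ 2 := by ring
  -- (vii) pull back along the chart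
  refine ⟨C₁ * (2 * K) ^ 2, by positivity, ?_⟩
  have hc : ContinuousAt e₀ x₀ := continuousAt_extChartAt x₀
  filter_upwards [hc.eventually hgood, extChartAt_source_mem_nhds (I := 𝓡 4) x₀] with x hx hxs
  have hxx : e₀.symm (e₀ x) = x := e₀.left_inv hxs
  rw [hxx] at hx
  exact hx

/-! ### The global bound on the complement of the ball (compact manifolds) -/

/-- **Global domination off the ball** (registered sub-goal `stub_collar_domination` of
`stub_collar`). On a punctured homotopy sphere (compact!), let `0 < ε`, `ε₂ < ε'`, the closed
`ε'`-ball inside the chart target, `J` standard on the punctured `ε'`-ball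
(`⟪A(Jv), c⟫ = ω₀(Av, c)`), and `α` a smooth `2`-form vanishing off the punctured `ε₂`-ball.
Then for one constant `C ≥ 0`, `|α_x(v, J_x v)| ≤ C ‖A_x v‖²` at every point `x` off the
punctured `ε`-ball and every `v`: `α` vanishes identically near every point off the `ε'`-ball
(the chart copy of the closed `ε₂`-ball is closed, `isClosed_setOf_extChartAt_mem`), the local
bounds `local_bound` serve near the points of the ball, and the complement of the `ε`-ball is
compact (`isCompact_compl_setOf_inPuncturedChartBall`). [cite: Gromov1985, 2.4.A] -/
theorem stub_collar_domination :
    ∀ (S : HomotopySphere 4) (p : S.carrier)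
      (J : ∀ x : punctured p, TangentSpace (𝓡 4) x →L[ℝ] TangentSpace (𝓡 4) x) (ε ε₂ ε' : ℝ),
      0 < ε → ε₂ < ε' →
      Metric.closedBall (extChartAt (𝓡 4) p p) ε' ⊆ (extChartAt (𝓡 4) p).target →
      (∀ x : punctured p, InPuncturedChartBall p ε' x →
        ∀ (v : TangentSpace (𝓡 4) x) (b : EuclideanSpace ℝ (Fin 4)),
          inner ℝ (fderiv ℝ inversion (extChartAt (𝓡 4) p x.1 - extChartAt (𝓡 4) p p)
            (mfderiv (𝓡 4) 𝓘(ℝ, EuclideanSpace ℝ (Fin 4))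
              (fun z : punctured p => extChartAt (𝓡 4) p z.1) x (J x v))) b
          = stdSymplecticForm (fderiv ℝ inversion (extChartAt (𝓡 4) p x.1 - extChartAt (𝓡 4) p p)
            (mfderiv (𝓡 4) 𝓘(ℝ, EuclideanSpace ℝ (Fin 4))
              (fun z : punctured p => extChartAt (𝓡 4) p z.1) x v)) b) →
      ∀ (α : MForm (𝓡 4) (punctured p) ℝ 2), IsSmoothForm α →
        (∀ x : punctured p, ¬ InPuncturedChartBall p ε₂ x → α x = 0) →
        ∃ C : ℝ, 0 ≤ C ∧ ∀ x : punctured p, ¬ InPuncturedChartBall p ε x →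
          ∀ v : TangentSpace (𝓡 4) x, |α x ![v, J x v]| ≤
            C * ‖fderiv ℝ inversion (extChartAt (𝓡 4) p x.1 - extChartAt (𝓡 4) p p)
              (mfderiv (𝓡 4) 𝓘(ℝ, EuclideanSpace ℝ (Fin 4))
                (fun z : punctured p => extChartAt (𝓡 4) p z.1) x v)‖ ^ 2 := by
  intro S p J ε ε₂ ε' hε hε₂' hball hJstd α hα hα0
  -- `α` vanishes identically near the points off the `ε'`-ball
  have hα0' : ∀ x : punctured p, ¬ InPuncturedChartBall p ε' x → ∀ᶠ z in 𝓝 x, α z = 0 := by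
    intro x hx
    have hW := isClosed_setOf_extChartAt_mem p
      (isCompact_closedBall (extChartAt (𝓡 4) p p) ε₂)
      ((Metric.closedBall_subset_closedBall hε₂'.le).trans hball)
    have hxW : ¬ (x.1 ∈ (chartAt (EuclideanSpace ℝ (Fin 4)) p).source ∧
        extChartAt (𝓡 4) p x.1 ∈ Metric.closedBall (extChartAt (𝓡 4) p p) ε₂) := fun h =>
      hx ⟨h.1, Metric.closedBall_subset_ball hε₂' h.2⟩
    filter_upwards [hW.isOpen_compl.mem_nhds hxW] with z hz
    refine hα0 z ?_
    rintro ⟨hzs, hzb⟩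
    exact hz ⟨hzs, Metric.ball_subset_closedBall hzb⟩
  -- one constant on the compact complement of the `ε`-ball
  have hK := gromov_recognitionR4_relEnd.isCompact_compl_setOf_inPuncturedChartBall p hε
  obtain ⟨C, hC, h⟩ := exists_const_of_isCompact hK
    (P := fun C x => ∀ v : TangentSpace (𝓡 4) x, |α x ![v, J x v]| ≤
      C * ‖fderiv ℝ inversion (extChartAt (𝓡 4) p x.1 - extChartAt (𝓡 4) p p)
        (mfderiv (𝓡 4) 𝓘(ℝ, EuclideanSpace ℝ (Fin 4))
          (fun z : punctured p => extChartAt (𝓡 4) p z.1) x v)‖ ^ 2)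
    (fun C C' x hCC' h v => (h v).trans (mul_le_mul_of_nonneg_right hCC' (sq_nonneg _)))
    (fun x _ => by
      by_cases hx : InPuncturedChartBall p ε' x
      · exact local_bound p hJstd (hα x) hx
      · refine ⟨0, le_rfl, (hα0' x hx).mono fun z hz v => ?_⟩
        simp [hz])
  exact ⟨C, hC, fun x hx v => h x hx v⟩

end Summit.SmoothPoincare4.SmoothPoincare4.Theorems.WitnessCharge.PencilIncompleteness
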